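import Summits.ResolutionOfSingularities.ResolutionOfSingularities.Theorems.AbsoluteQFrameRing
import HarnessLib

/-!
# AbsoluteQFrameIndep — decomp-res node «AbsoluteContactInsep» (lens-6 g18), tree file 5/10 of the node

Content VERBATIM from the decomp-res lens-6 g18 file `HOME/decomp-res-lens-6/g18/AbsoluteContactInsep.lean` (sha256
3771488be5d3cd2c, 1966 l; HOME =
run/shared/lean/pub/decomp-res).  Critic: CRITIC-LEDGER row 139 (CLEARED 2026-08-30T20:11:48Z, DECIDED +1:
`AbsContactOff3` proved for every p ≠ 3 and every
field, hypothesis-free); split per the lens's NODE-g18 §8 writer package (sections kept whole; two packages halved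
for the 400-line limit).  Landed by
decomp-res writer g7 in the lens's namespace `…Theorems.AbsoluteContactClasses` (cone-free chain); the wiring
`Theorems/MaxContactCutAbsContactOff3`
(`agAbsContactOff3 : AGAbsContactOff3`, item 27752) follows the chain.  No new aside, nothing superseded; asides
31574 / 27753 / 27896 are ⟺ each other
hypothesis-free by this node.

Section `IndepCore` (l. 896–1127).

[WRITER NOTE (decomp-res writer g7): file split only; namespace, opens, section variables and every declaration
exactly as in the lens (global `set_option` dropped).]

(Sources: Giraud1975; EGA IV 16.11.2, 0_IV 21.9; KimuraNiitsuma1980 Thm 3.4; EncinasVillamayor2000 Thm 4.9;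
BravoGarciaEscamillaVillamayor2012 Lemma 4.6; Hironaka1964; CossartJannsenSaito2020; CossartPiltant2019; Kunz1969.)
-/

noncomputable section

open CategoryTheory AlgebraicGeometry TopologicalSpace
open Literature.AlgebraicGeometry.Resolution
open Summit.ResolutionOfSingularities.ResolutionOfSingularities.Theorems
open WeakOrderReduction ForcedTowerClasses PurityValveClasses
open SatelliteExitClasses
open IsLocalRing MvPolynomial

namespace Summit.ResolutionOfSingularities.ResolutionOfSingularities.Theorems.AbsoluteContactClasses

section IndepCore

/-! ### B.2 Independence of the box monomials over `R^{p^e}[b]` (initial forms + digit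
uniqueness + the easy Kunz lemma + Krull) -/

variable {R : Type*} [CommRing R]

/-- exponent vector of a box index. -/
def boxExp {d q : ℕ} (γ : Fin d → Fin q) : Fin d →₀ ℕ := Finsupp.equivFunOnFinite.symm fun i => (γ i : ℕ)

/-- `boxExp_apply`: Auxiliary step of this node's calculus, VERBATIM from the lens file (see the module docstring);
the statement is its type. [folklore] -/
@[simp] theorem boxExp_apply {d q : ℕ} (γ : Fin d → Fin q) (i : Fin d) : boxExp γ i = (γ i : ℕ) := rfl

/-- `boxMon_eq_uMon`: Auxiliary step of this node's calculus, VERBATIM from the lens file (see the module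
docstring); the statement is its type. [folklore] -/
theorem boxMon_eq_uMon {d q : ℕ} (u : Fin d → R) (γ : Fin d → Fin q) : boxMon q u γ = uMon u (boxExp γ) := rfl

/-- `uMon_add`: Auxiliary step of this node's calculus, VERBATIM from the lens file (see the module docstring); the
statement is its type. [folklore] -/
theorem uMon_add {d : ℕ} (u : Fin d → R) (α β : Fin d →₀ ℕ) : uMon u (α + β) = uMon u α * uMon u β := by
  rw [uMon, uMon, uMon, ← Finset.prod_mul_distrib]
  exact Finset.prod_congr rfl fun i _ => by rw [Finsupp.add_apply, pow_add]

/-- `uMon_nsmul`: Auxiliary step of this node's calculus, VERBATIM from the lens file (see the module docstring);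
the statement is its type. [folklore] -/
theorem uMon_nsmul {d : ℕ} (u : Fin d → R) (q : ℕ) (α : Fin d →₀ ℕ) : uMon u (q • α) = uMon u α ^ q := by
  rw [uMon, uMon, ← Finset.prod_pow]
  exact Finset.prod_congr rfl fun i _ => by rw [Finsupp.smul_apply, smul_eq_mul, pow_mul']

/-- `eval_monomial_uMon`: Auxiliary step of this node's calculus, VERBATIM from the lens file (see the module
docstring); the statement is its type. [folklore] -/
theorem eval_monomial_uMon {d : ℕ} (u : Fin d → R) (ν : Fin d →₀ ℕ) (c : R) :
    eval u (monomial ν c) = c * uMon u ν := by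
  have : monomial ν c = C c * monomial ν 1 := by rw [C_mul_monomial, mul_one]
  rw [this, map_mul, eval_C, uMon_eq_eval]

/-- `eval_eq_sum_uMon`: Auxiliary step of this node's calculus, VERBATIM from the lens file (see the module
docstring); the statement is its type. [folklore] -/
theorem eval_eq_sum_uMon {d : ℕ} (u : Fin d → R) (F : MvPolynomial (Fin d) R) {s : Finset (Fin d →₀ ℕ)}
    (hs : F.support ⊆ s) : eval u F = ∑ ν ∈ s, coeff ν F * uMon u ν := by
  classical
  conv_lhs => rw [F.as_sum, map_sum]
  rw [← Finset.sum_subset hs (fun ν _ hν => by rw [notMem_support_iff.mp hν, zero_mul])]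
  exact Finset.sum_congr rfl fun ν _ => eval_monomial_uMon u ν _

/-- digit uniqueness: `q•ν + γ = q•ν₀ + γ₀` with `γ, γ₀ < q` forces `ν = ν₀`, `γ = γ₀`. [folklore] -/
theorem digit_eq_iff {d q : ℕ} (hq : 0 < q) (ν ν₀ : Fin d →₀ ℕ) (γ γ₀ : Fin d → Fin q) :
    q • ν + boxExp γ = q • ν₀ + boxExp γ₀ ↔ ν = ν₀ ∧ γ = γ₀ := by
  constructor
  · intro h
    have hi : ∀ i, q * ν i + (γ i : ℕ) = q * ν₀ i + (γ₀ i : ℕ) := fun i => by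
      have := DFunLike.congr_fun h i
      simpa [Finsupp.add_apply, Finsupp.smul_apply] using this
    have hν : ∀ i, ν i = ν₀ i := fun i => by
      have h1 : (q * ν i + (γ i : ℕ)) / q = (q * ν₀ i + (γ₀ i : ℕ)) / q := by rw [hi i]
      rwa [Nat.mul_add_div hq, Nat.mul_add_div hq, Nat.div_eq_of_lt (γ i).isLt,
        Nat.div_eq_of_lt (γ₀ i).isLt, add_zero, add_zero] at h1
    have hγ : ∀ i, (γ i : ℕ) = (γ₀ i : ℕ) := fun i => by
      have h1 : (q * ν i + (γ i : ℕ)) % q = (q * ν₀ i + (γ₀ i : ℕ)) % q := by rw [hi i]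
      rwa [Nat.mul_add_mod, Nat.mul_add_mod, Nat.mod_eq_of_lt (γ i).isLt,
        Nat.mod_eq_of_lt (γ₀ i).isLt] at h1
    exact ⟨Finsupp.ext hν, funext fun i => Fin.ext (hγ i)⟩
  · rintro ⟨rfl, rfl⟩; rfl

variable (p e : ℕ) [Fact p.Prime] [CharP R p] {ι : Type*} (b : ι → R)

/-- `sum_pow_char_pow'`: Auxiliary step of this node's calculus, VERBATIM from the lens file (see the module
docstring); the statement is its type. [folklore] -/
theorem sum_pow_char_pow' {α : Type*} (s : Finset α) (f : α → R) :
    (∑ a ∈ s, f a) ^ p ^ e = ∑ a ∈ s, f a ^ p ^ e := by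
  have h := map_sum (iterateFrobenius R p e) f s
  simpa only [iterateFrobenius_def] using h

variable [IsRegularLocalRing R] {d : ℕ} (hd : (maximalIdeal R).spanFinrank = d) (u : Fin d → R)
  (hu : Ideal.span (Set.range u) = maximalIdeal R)

include hd hu

/-- **One step of the independence argument.** Given reduced `G_γ` with `Σ_γ ev(G_γ) u^γ = 0`
and `coeff_μ G_γ ∈ 𝔪^{n_γ}`, at the minimal level `ℓ = q n_γ + |γ|` the coefficients improve to
`𝔪^{n_γ + 1}` (initial forms in `gr_𝔪 R = K[U]`, digit uniqueness, easy Kunz). [folklore] -/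
theorem indep_step (hT : QIndep (p ^ e) (fun i => residue R (b i)))
    (G : (Fin d → Fin (p ^ e)) → MvPolynomial ι R) (hG : ∀ γ, IsReduced (p ^ e) (G γ))
    (hrel : ∑ γ, frobEval p e b (G γ) * boxMon (p ^ e) u γ = 0)
    (n : (Fin d → Fin (p ^ e)) → ℕ) (hn : ∀ γ μ, coeff μ (G γ) ∈ maximalIdeal R ^ n γ)
    (ℓ : ℕ) (hℓ : ∀ γ, ℓ ≤ p ^ e * n γ + (boxExp γ).degree)
    (γ₀ : Fin d → Fin (p ^ e)) (hγ₀ : p ^ e * n γ₀ + (boxExp γ₀).degree = ℓ) (μ₀ : ι →₀ ℕ) :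
    coeff μ₀ (G γ₀) ∈ maximalIdeal R ^ (n γ₀ + 1) := by
  classical
  have hq : 0 < p ^ e := pow_pos (Fact.out : p.Prime).pos e
  by_cases hμ₀ : μ₀ ∈ (G γ₀).support
  swap
  · rw [notMem_support_iff.mp hμ₀]; exact zero_mem _
  -- initial forms of the coefficients
  have hform : ∀ γ μ, ∃ F : MvPolynomial (Fin d) R, F.IsHomogeneous (n γ) ∧ eval u F = coeff μ (G γ) :=
    fun γ μ => exists_isHomogeneous_of_mem_span_pow u (n γ) (by rw [hu]; exact hn γ μ)
  choose F hFh hFe using hform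
  have hFdeg : ∀ γ μ ν, ν ∈ (F γ μ).support → ν.degree = n γ := fun γ μ ν hν => by
    rw [Finsupp.degree_eq_weight_one]
    exact hFh γ μ (mem_support_iff.mp hν)
  -- the indices at level `ℓ`, the exponents `ν` in play, and the regrouped polynomials `H γ ν`
  set Z : Finset (Fin d → Fin (p ^ e)) := Finset.univ.filter fun γ => (p ^ e) * n γ + (boxExp γ).degree = ℓ with hZ
  have hγ₀Z : γ₀ ∈ Z := by rw [hZ, Finset.mem_filter]; exact ⟨Finset.mem_univ _, hγ₀⟩
  let NU : (Fin d → Fin (p ^ e)) → Finset (Fin d →₀ ℕ) := fun γ => (G γ).support.biUnion fun μ => (F γ μ).support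
  have hNU : ∀ γ μ, μ ∈ (G γ).support → (F γ μ).support ⊆ NU γ := fun γ μ hμ =>
    Finset.subset_biUnion_of_mem (fun μ => (F γ μ).support) hμ
  have hNUdeg : ∀ γ, ∀ ν ∈ NU γ, ν.degree = n γ := fun γ ν hν => by
    obtain ⟨μ, hμ, hν'⟩ := Finset.mem_biUnion.mp hν
    exact hFdeg γ μ ν hν'
  let H : (Fin d → Fin (p ^ e)) → (Fin d →₀ ℕ) → MvPolynomial ι R := fun γ ν =>
    ∑ μ ∈ (G γ).support, monomial μ (coeff ν (F γ μ))
  have hHred : ∀ γ ν, IsReduced (p ^ e) (H γ ν) := fun γ ν =>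
    IsReduced.sum _ _ fun μ hμ => isReduced_monomial (hG γ μ hμ) _
  have hHcoeff : ∀ γ ν, ∀ μ ∈ (G γ).support, coeff μ (H γ ν) = coeff ν (F γ μ) := fun γ ν μ hμ => by
    simp only [H, coeff_sum, coeff_monomial]
    rw [Finset.sum_ite_eq' (G γ).support μ, if_pos hμ]
  have hHev : ∀ γ ν, frobEval p e b (H γ ν) = ∑ μ ∈ (G γ).support, coeff ν (F γ μ) ^ (p ^ e) * bMon b μ := fun γ ν => by
    simp only [H, map_sum, frobEval_monomial]
  -- the form `Ψ` of degree `ℓ`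
  let Ψ : MvPolynomial (Fin d) R := ∑ γ ∈ Z, ∑ ν ∈ NU γ, monomial ((p ^ e) • ν + boxExp γ) (frobEval p e b (H γ ν))
  have hΨhom : Ψ.IsHomogeneous ℓ := by
    refine IsHomogeneous.sum _ _ _ fun γ hγ => IsHomogeneous.sum _ _ _ fun ν hν => isHomogeneous_monomial _ ?_
    have hγℓ := (Finset.mem_filter.mp hγ).2
    rw [map_add, map_nsmul, hNUdeg γ ν hν, smul_eq_mul, hγℓ]
  -- `eval u Ψ = Σ_{γ ∈ Z} ev(G γ) u^γ`
  have hΨeval : eval u Ψ = ∑ γ ∈ Z, frobEval p e b (G γ) * boxMon (p ^ e) u γ := by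
    simp only [Ψ, map_sum, eval_monomial_uMon, uMon_add, uMon_nsmul, ← boxMon_eq_uMon]
    refine Finset.sum_congr rfl fun γ _ => ?_
    -- Σ_ν ev(H γ ν) * ((uMon ν)^(p ^ e) * boxMon γ) = ev(G γ) * boxMon γ
    have hswap : ∑ ν ∈ NU γ, frobEval p e b (H γ ν) * (uMon u ν ^ (p ^ e) * boxMon (p ^ e) u γ) =
        (∑ μ ∈ (G γ).support, bMon b μ * ∑ ν ∈ NU γ, (coeff ν (F γ μ) * uMon u ν) ^ (p ^ e)) * boxMon (p ^ e) u γ := by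
      simp only [hHev, Finset.sum_mul, Finset.mul_sum, mul_pow]
      rw [Finset.sum_comm]
      refine Finset.sum_congr rfl fun μ _ => Finset.sum_congr rfl fun ν _ => by ring
    rw [hswap, frobEval_apply]
    congr 1
    refine Finset.sum_congr rfl fun μ hμ => ?_
    rw [← sum_pow_char_pow' p e, ← eval_eq_sum_uMon u (F γ μ) (hNU γ μ hμ), hFe, mul_comm]
  -- `eval u Ψ ∈ 𝔪^{ℓ+1}` from the relation
  have hlow : ∀ γ, frobEval p e b (G γ) * boxMon (p ^ e) u γ ∈ maximalIdeal R ^ ((p ^ e) * n γ + (boxExp γ).degree) := by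
    intro γ
    rw [pow_add]
    refine Ideal.mul_mem_mul ?_ ?_
    · rw [frobEval_apply, pow_mul]
      refine Ideal.sum_mem _ fun μ _ => Ideal.mul_mem_right _ _ ?_
      rw [← pow_mul, mul_comm, pow_mul]
      exact Ideal.pow_mem_pow (hn γ μ) (p ^ e)
    · rw [boxMon_eq_uMon, ← hu]; exact uMon_mem_pow u _
  have hΨmem : eval u Ψ ∈ maximalIdeal R ^ (ℓ + 1) := by
    have hsplit := Finset.sum_filter_add_sum_filter_not Finset.univ
      (fun γ => (p ^ e) * n γ + (boxExp γ).degree = ℓ) (fun γ => frobEval p e b (G γ) * boxMon (p ^ e) u γ)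
    rw [hrel] at hsplit
    have : eval u Ψ = -∑ γ ∈ Finset.univ.filter (fun γ => ¬ (p ^ e) * n γ + (boxExp γ).degree = ℓ),
        frobEval p e b (G γ) * boxMon (p ^ e) u γ := by
      rw [hΨeval, hZ]; exact eq_neg_of_add_eq_zero_left hsplit
    rw [this]
    refine neg_mem (Ideal.sum_mem _ fun γ hγ => ?_)
    have hne := (Finset.mem_filter.mp hγ).2
    have hle : ℓ + 1 ≤ (p ^ e) * n γ + (boxExp γ).degree := by have := hℓ γ; omega
    exact Ideal.pow_le_pow_right hle (hlow γ)
  -- quasi-regularity: the coefficients of `Ψ` lie in `𝔪`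
  have hΨcoeff : ∀ ε, coeff ε Ψ ∈ maximalIdeal R := coeff_mem_maximalIdeal_of_eval_mem_pow hd u hu hΨhom hΨmem
  -- extract the coefficient at `(p ^ e)•ν₀ + γ₀`
  have hcoeffΨ : ∀ ν₀ ∈ NU γ₀, coeff ((p ^ e) • ν₀ + boxExp γ₀) Ψ = frobEval p e b (H γ₀ ν₀) := by
    intro ν₀ hν₀
    simp only [Ψ, coeff_sum, coeff_monomial]
    rw [Finset.sum_eq_single γ₀]
    · have : ∀ ν ∈ NU γ₀, (if (p ^ e) • ν + boxExp γ₀ = (p ^ e) • ν₀ + boxExp γ₀ then frobEval p e b (H γ₀ ν) else 0) =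
          if ν = ν₀ then frobEval p e b (H γ₀ ν) else 0 := fun ν _ => by
        simp only [digit_eq_iff hq, and_true]
      rw [Finset.sum_congr rfl this, Finset.sum_ite_eq' (NU γ₀) ν₀, if_pos hν₀]
    · intro γ _ hne
      refine Finset.sum_eq_zero fun ν _ => ?_
      rw [if_neg]
      rw [digit_eq_iff hq]
      exact fun h => hne h.2
    · exact fun h => (h hγ₀Z).elim
  -- hence every coefficient of `F γ₀ μ₀` lies in `𝔪`
  have hFcoeff : ∀ ν₀, coeff ν₀ (F γ₀ μ₀) ∈ maximalIdeal R := by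
    intro ν₀
    by_cases hν₀ : ν₀ ∈ NU γ₀
    · have hmem : frobEval p e b (H γ₀ ν₀) ∈ maximalIdeal R := by
        rw [← hcoeffΨ ν₀ hν₀]; exact hΨcoeff _
      have := coeff_mem_maximalIdeal_of_frobEval_mem p e b hT (hHred γ₀ ν₀) hmem μ₀
      rwa [hHcoeff γ₀ ν₀ μ₀ hμ₀] at this
    · have : ν₀ ∉ (F γ₀ μ₀).support := fun h => hν₀ (hNU γ₀ μ₀ hμ₀ h)
      rw [notMem_support_iff.mp this]; exact zero_mem _
  -- conclude with `eval u F ∈ 𝔪 · 𝔪^{n γ₀}`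
  rw [← hFe γ₀ μ₀, pow_succ', ← hu]
  have := eval_mem_mul_span_pow u (hFh γ₀ μ₀) ((mem_map_C_iff (I := Ideal.span (Set.range u))).mpr
    (by rw [hu]; exact hFcoeff))
  rwa [hu] at this ⊢

/-- **Independence core**: reduced `G_γ` with `Σ_γ ev(G_γ) u^γ = 0` vanish. [folklore] -/
theorem indepCore (hT : QIndep (p ^ e) (fun i => residue R (b i)))
    (G : (Fin d → Fin (p ^ e)) → MvPolynomial ι R) (hG : ∀ γ, IsReduced (p ^ e) (G γ))
    (hrel : ∑ γ, frobEval p e b (G γ) * boxMon (p ^ e) u γ = 0) : ∀ γ, G γ = 0 := by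
  classical
  have hq : 0 < p ^ e := pow_pos (Fact.out : p.Prime).pos e
  -- all levels: `∀ ℓ, ∃ n, (∀ γ, ℓ ≤ q n γ + |γ|) ∧ coeff ∈ 𝔪^{n γ}`
  have hlev : ∀ ℓ : ℕ, ∃ n : (Fin d → Fin (p ^ e)) → ℕ,
      (∀ γ, ℓ ≤ p ^ e * n γ + (boxExp γ).degree) ∧ ∀ γ μ, coeff μ (G γ) ∈ maximalIdeal R ^ n γ := by
    intro ℓ
    induction ℓ with
    | zero => exact ⟨fun _ => 0, fun _ => Nat.zero_le _, fun γ μ => by simp⟩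
    | succ ℓ ih =>
      obtain ⟨n, hnℓ, hn⟩ := ih
      refine ⟨fun γ => if p ^ e * n γ + (boxExp γ).degree = ℓ then n γ + 1 else n γ, fun γ => ?_, fun γ μ => ?_⟩
      · by_cases h : p ^ e * n γ + (boxExp γ).degree = ℓ
        · dsimp only; rw [if_pos h, mul_add, mul_one]; have := hnℓ γ; omega
        · dsimp only; rw [if_neg h]; have := hnℓ γ; omega
      · by_cases h : p ^ e * n γ + (boxExp γ).degree = ℓ
        · dsimp only; rw [if_pos h]; exact indep_step p e b hd u hu hT G hG hrel n hn ℓ hnℓ γ h μ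
        · dsimp only; rw [if_neg h]; exact hn γ μ
  intro γ
  ext μ
  rw [coeff_zero]
  have hmem : coeff μ (G γ) ∈ ⨅ m : ℕ, maximalIdeal R ^ m := by
    refine Ideal.mem_iInf.mpr fun m => ?_
    obtain ⟨n, hnℓ, hn⟩ := hlev (p ^ e * m + (boxExp γ).degree)
    have hm : m ≤ n γ := by
      have := hnℓ γ
      exact Nat.le_of_mul_le_mul_left (by omega) hq
    exact Ideal.pow_le_pow_right hm (hn γ μ)
  rwa [Ideal.iInf_pow_eq_bot_of_isLocalRing _ (maximalIdeal.isMaximal R).ne_top, Ideal.mem_bot] at hmem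

/-- **Linear independence of the box monomials over `R^{p^e}[b]`.** [folklore] -/
theorem linearIndependent_boxMon (hT : QIndep (p ^ e) (fun i => residue R (b i))) :
    LinearIndependent (frobSubring p e b) (boxMon (p ^ e) u) := by
  classical
  rw [Fintype.linearIndependent_iff]
  intro g hg γ
  have hG : ∀ γ, ∃ G, IsReduced (p ^ e) G ∧ frobEval p e b G = (g γ : R) := fun γ =>
    exists_isReduced_of_mem p e b (g γ).2
  choose G hGr hGe using hG
  have hrel : ∑ γ, frobEval p e b (G γ) * boxMon (p ^ e) u γ = 0 := by
    have : ∑ γ, (g γ : R) * boxMon (p ^ e) u γ = 0 := by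
      simpa only [Subring.smul_def, smul_eq_mul] using hg
    simpa only [hGe] using this
  have := indepCore p e b hd u hu hT G hGr hrel γ
  apply Subtype.ext
  rw [← hGe γ, this, map_zero]; rfl

end IndepCore

end Summit.ResolutionOfSingularities.ResolutionOfSingularities.Theorems.AbsoluteContactClasses
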